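import Summits.ABC.IUTFork.Cor312ThetaLocalUpperPrVolTuple
import Summits.ABC.IUTFork.Thm311RealInd1Criterion
import HarnessLib

/-!
# [IUTchIII] Cor. 3.12 — the per-TUPLE LOWER bound on the Θ-side local terms `−|log(Θ)|_{j,p}` at the print-normalised
# assembled real setting with pilot regions read off ideles: (Ind1) alone raises the local Θ-volume to the
# symmetrised value `Σ_{v⃗} Pr(v⃗)·log max_a ‖t_{Θ,i+1,v_a}‖`, at EVERY prime

PROOF-ONLY support piece of the abc-iut cell (R2 S-chain team, seat abc-iut-s2-p6, TARGET #2 `hΘ`; F-side companion of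
`Cor312ThetaLocalUpperPrVolTuple` p437284). TAKES NO SIDE on [IUTchIII] Cor. 3.12; theorems only, 0 `def`s, no new `Prop`
fact, no instance. S. Mochizuki, *Inter-universal Teichmüller theory III*, Cor. 3.12 (kurims May-2020 ms pp. 173–175): the
Θ-side quantity is the log-volume of "the holomorphic hull of the union of the possible images of a Θ-pilot object …
subject to the indeterminacies (Ind1), (Ind2), (Ind3)". Dupuy–Hilado, arXiv:2004.13228 §4.7 "(Ind1) … permutations",
§4.12 "hull = the smallest polydisc containing".

At abc-iut-c312-7's `Real.settingPrVolSharp` the (Ind3)-region at `(i+1, p)` is `e⁻¹(Π_{v⃗} ι_{last}(t_{Θ,i+1,v_{last}})·(R_I)^∼)`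
(abc-iut-c312-3's sharp boxes): the Θ-idele sits in the LAST tensor slot only. Its image under the capsule permutation
`σ` (an (Ind1)-family: abc-iut-c312-5 `permFamily_mem_closure`) is `e⁻¹(Π_{v⃗} ι_{σ(last)}(t_{Θ,i+1,v_{σ(last)}})·(R_I)^∼)`
(abc-iut-w5-d216 `permX_image_iota_smul_normalizedPacket`), a possible image; so every hull-set `e⁻¹(λ·𝒪_L)` containing
the union of the possible images has `‖λ_{(v⃗,i)}‖ ≥ max_a ‖t_{Θ,i+1,v_a}‖` (it contains the point `e⁻¹(ι_a(t_{v_a}))_{v⃗}`,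
whose field-factor coordinates all have norm `‖t_{v_a}‖`, abc-iut-c312-3 `norm_dEquiv_iota`). Hence:

* §1 `permute_image_thetaRegion3_settingPrVolSharp` — the permuted (Ind3)-region in closed form, and
  `permute_image_thetaRegion3_mem_possibleImages`;
* §2 `norm_le_of_hullSet_of_sUnion_possibleImages_subset` — the radii of an enclosing hull-set dominate every slot's idele;
* §3 **`sum_log_max_norm_le_thetaLocal_settingPrVolSharp_untopD`** — `Σ_{v⃗} Pr(v⃗)·log max_a ‖t_{Θ,i+1,v_a}‖ ≤ −|log(Θ)|_{i+1,p}`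
  at EVERY prime (the hull-set of the max-radii lies in the hull; monotone log-volume, abc-iut-c312-6 `BridgeHyps.mono`;
  its volume by `logvol_situationPrVol_preimage_hullSet_of_norm_eq`). With p437284's upper bound this is the SANDWICH
  `MAIN ≤ −|log(Θ)|_{i+1,p} ≤ MAIN + log(p²·R/r)`, `MAIN := Σ_{v⃗} Pr(v⃗)·log max_a ‖t_{Θ,i+1,v_a}‖`: the typed (Ind1)/(Ind2)-hull
  of print's own sharp Θ-regions sits within a t-INDEPENDENT constant ABOVE the (Ind1)-symmetrised sharp volume — for
  realising ideles `MAIN = −Σ_{v⃗} Pr(v⃗)·min_a P_{Θ,i+1}(v_a)·ln|κ(v_a)|/n_{v_a}` ([IUTchIV] Thm. 1.10 Step (v)'s `min` over the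
  tuple; Scholze–Stix's "`j²` vs `j`" loss in numbers: only the all-bad tuples keep Θ-gain), strictly above the single
  Kummer image's `−Σ_{v⃗} Pr(v⃗)·P_{Θ,i+1}(v_{last})·…` wherever a prime under `S` has bad mass `< 1`.

Sources: [IUTchIII] pp. 173–175; [IUTchIV] Thm. 1.10 Step (v) pp. 27–28. [cite: DupuyHilado2025, §3.9, §4.7, §4.12]
[cite: ScholzeStix2018, §2.2 pp. 9–10] [claim: Mochizuki2012, status: disputed]
HONEST FRAMING / SCOPE: (Ind1) as typed (capsule permutations, abc-iut-c312-5 `logShellsDH`); the SHARP (Ind3) reading; the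
lower bound uses NO property of (Ind2). Nothing here asserts or denies [IUTchIII] Cor. 3.12 for initial Θ-data; a statement
about OUR typed objects. typed ≠ proved; instantiated ≠ endorsed.
-/

noncomputable section

open Set Function
open scoped Pointwise

namespace Summit.ABC

namespace IUTFork

namespace Thm311

namespace Real

open Cor312 Cor312.Setting Cor312Vol Literature.IUT.LogThetaLattice Literature.IUT.LogVolume

variable {F : Type} [Field F] [NumberField F] (X : PilotData F) {logv : PadicLogs F} (hlog : LogvAnalytic logv)
  (M : Type) [Field M] [NumberField M]
  (archPk : ∀ (j : (thetaIndex X).Label) (vQ : (thetaIndex X).VQ), Set ((logShellsDH X logv).Packet j vQ))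
  (archSub : ∀ (j : (thetaIndex X).Label) (v : (thetaIndex X).V),
    Set ((logShellsDH X logv).Packet j ((thetaIndex X).over v)))
  (Ψ : ℤ → ∀ v : (thetaIndex X).V, v ∈ (thetaIndex X).Vbad → Set ((logShellsDH X logv).StarPacket v))
  (act : ℤ → ∀ v : (thetaIndex X).V, v ∈ (thetaIndex X).Vbad →
    (logShellsDH X logv).StarPacket v → Module.End ℚ ((logShellsDH X logv).StarPacket v))
  (Mmod : ℤ → ∀ j : (thetaIndex X).LabelStar, Set ((logShellsDH X logv).GlobalPacket j.1))
  (region : ℤ → ∀ j : (thetaIndex X).LabelStar, FinDivisor M → ∀ vQ : (thetaIndex X).VQ,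
    Set ((logShellsDH X logv).Packet j.1 vQ))
  (n : ℤ) {HT : Type} {LogLink : HT → HT → Type} {IsFull : ∀ {s t : HT}, LogLink s t → Prop}
  (lat : LGPGaussianLogThetaLattice LogLink IsFull)
  {Frd : Type} {IsoF : Frd → Frd → Type} {Ob : Frd → Type} {realify : Frd → Frd} {Strip : Type}
  {IsoS : Strip → Strip → Type} {Mv : ∀ v : (thetaIndex X).V, v ∈ (thetaIndex X).Vbad → Type}
  [∀ v h, Monoid (Mv v h)]
  (sig : GlobalLGPFrobenioidSignature (thetaIndex X).lstar (thetaIndex X).V (· ∈ (thetaIndex X).Vbad)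
    Frd IsoF Ob realify Strip IsoS Mv)
  (split : SplittingMonoids Mv) {ObΔ : Type} {N : ∀ v : (thetaIndex X).V, v ∈ (thetaIndex X).Vbad → Type}
  [∀ v h, Monoid (N v h)] (qData : QPilotData ObΔ N)
  (t : ∀ (pp : Nat.Primes) (_ : Fin X.lstar) (x : (thetaIndex X).Fibre (.inr pp)),
    haveI : Fact (pp : ℕ).Prime := ⟨pp.2⟩; kOf X pp.1 x)
  (tq : ∀ (pp : Nat.Primes) (x : (thetaIndex X).Fibre (.inr pp)), haveI : Fact (pp : ℕ).Prime := ⟨pp.2⟩; kOf X pp.1 x)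
  (htq0 : ∀ pp x, tq pp x ≠ 0)
  (htq1 : ∀ (pp : Nat.Primes) (x : (thetaIndex X).Fibre (.inr pp)),
    haveI : Fact (pp : ℕ).Prime := ⟨pp.2⟩; placeOf X pp.1 x ∉ X.S → ‖tq pp x‖ = 1)

/-! ## §1. The capsule permutations of the sharp (Ind3)-region are possible images, in closed form -/

/-- The (Ind3)-region of `settingPrVolSharp` at `(j, p)` is `e⁻¹(Π_{v⃗} ι_{last}(t_{Θ,j,v_{last}})·(R_I)^∼)` (abc-iut-c312-7
`thetaRegion3_thetaBoxDH_Pr` + abc-iut-c312-3 `factorMap_preimage_boxOf`). [cite: DupuyHilado2025, §3.9] -/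
theorem thetaRegion3_settingPrVolSharp_eq_preimage_pi (j : (thetaIndex X).Label) (pp : Nat.Primes) :
    haveI : Fact (pp : ℕ).Prime := ⟨pp.2⟩
    (settingPrVolSharp X hlog M archPk archSub Ψ act Mmod region n lat sig split qData tq t htq0 htq1).thetaRegion3 j
        (.inr pp) =
      (presAt X hlog pp).comparison j ⁻¹' Set.pi univ (sharpBoxDH X hlog t pp j) := by
  haveI : Fact (pp : ℕ).Prime := ⟨pp.2⟩
  have h : (settingPrVolSharp X hlog M archPk archSub Ψ act Mmod region n lat sig split qData tq t htq0 htq1).thetaRegion3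
      j (.inr pp) = factorMapDH X hlog j (.inr pp) ⁻¹' thetaBoxDH X hlog (sharpBoxDH X hlog t) j (.inr pp) :=
    thetaRegion3_thetaBoxDH_Pr X hlog M archPk archSub Ψ act Mmod region n lat sig split qData _ _ _ _ j (.inr pp)
  rw [h]
  exact (presAt X hlog pp).factorMap_preimage_boxOf (sharpBoxDH X hlog t pp j)

/-- **The capsule permutation `σ` carries the sharp (Ind3)-region to `e⁻¹(Π_{v⃗} ι_{σ(last)}(t_{Θ,j,v_{σ(last)}})·(R_I)^∼)`**
(abc-iut-c312-5 `comparison_permute`, `permΨ_image_pi`; abc-iut-w5-d216 `permX_image_iota_smul_normalizedPacket`).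
[cite: DupuyHilado2025, §4.7] -/
theorem permute_image_thetaRegion3_settingPrVolSharp (j : (thetaIndex X).Label) (pp : Nat.Primes)
    (σ : Equiv.Perm ((thetaIndex X).Caps j)) :
    haveI : Fact (pp : ℕ).Prime := ⟨pp.2⟩
    (logShellsDH X logv).permute j (.inr pp) σ ''
        (settingPrVolSharp X hlog M archPk archSub Ψ act Mmod region n lat sig split qData tq t htq0 htq1).thetaRegion3 j
          (.inr pp) =
      (presAt X hlog pp).comparison j ⁻¹' Set.pi univ fun e =>
        iota pp.1 ((presAt X hlog pp).kk e) (σ (Fin.last _)) (labelIdele X t pp j (e (σ (Fin.last _)))) •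
          (normalizedPacket pp.1 ((presAt X hlog pp).kk e) : Set ((presAt X hlog pp).X e)) := by
  haveI : Fact (pp : ℕ).Prime := ⟨pp.2⟩
  rw [thetaRegion3_settingPrVolSharp_eq_preimage_pi]
  refine image_preimage_eq_of_semiconj' ((logShellsDH X logv).permute j (.inr pp) σ).surjective
    ((presAt X hlog pp).permΨ σ).injective ((presAt X hlog pp).comparison_permute σ) ?_
  rw [(presAt X hlog pp).permΨ_image_pi]
  refine Set.pi_congr rfl fun e _ => ?_
  exact (presAt X hlog pp).permX_image_iota_smul_normalizedPacket σ e (Fin.last _) _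

/-- **Every capsule permutation of the (Ind3)-region is a possible image** (abc-iut-c312-5 `permFamily_mem_closure`:
`permute σ` at one label is an (Ind1)-family). [claim: Mochizuki2012, status: disputed] -/
theorem permute_image_thetaRegion3_mem_possibleImages (j : (thetaIndex X).Label) (vQ : (thetaIndex X).VQ)
    (σ : Equiv.Perm ((thetaIndex X).Caps j)) :
    (logShellsDH X logv).permute j vQ σ ''
        (settingPrVolSharp X hlog M archPk archSub Ψ act Mmod region n lat sig split qData tq t htq0 htq1).thetaRegion3 j
          vQ ∈
      (settingPrVolSharp X hlog M archPk archSub Ψ act Mmod region n lat sig split qData tq t htq0 htq1).possibleImages j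
        vQ :=
  ⟨(logShellsDH X logv).permFamily j σ, (logShellsDH X logv).permFamily_mem_closure j σ, by
    rw [LogShells.permFamily_apply_self]; rfl⟩

/-! ## §2. The radii of an enclosing hull-set dominate every slot's Θ-idele -/

/-- **If a hull-set `e⁻¹(λ·𝒪_L)` contains the union of the possible images at `(i+1, p)`, then
`‖t_{Θ,i+1,v_a}‖ ≤ ‖λ_{(v⃗,i)}‖` for every tuple `v⃗`, slot `a` and field factor `i`**: it contains the permuted region
putting `t_{Θ,i+1,v_a}` in slot `a` (`σ = swap a last`), hence the point `e⁻¹((ι_a(t_{Θ,i+1,v_a}))_{v⃗})`, whose coordinates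
have norm `‖t_{Θ,i+1,v_a}‖` (abc-iut-c312-3 `norm_dEquiv_iota`). [cite: DupuyHilado2025, §4.7, §4.12] -/
theorem norm_le_of_hullSet_of_sUnion_possibleImages_subset (pp : Nat.Primes) (i₀ : Fin (thetaIndex X).lstar) :
    haveI : Fact (pp : ℕ).Prime := ⟨pp.2⟩
    ∀ (c : ∀ s : (presAt X hlog pp).factorIdx (labelSucc i₀), (presAt X hlog pp).factorField (labelSucc i₀) s),
      (⋃₀ (settingPrVolSharp X hlog M archPk archSub Ψ act Mmod region n lat sig split qData tq t htq0 htq1).possibleImages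
          (labelSucc i₀) (.inr pp) ⊆
        (fun x => (presAt X hlog pp).factorMap (labelSucc i₀) x) ⁻¹' hullSet ((presAt X hlog pp).factorField _) c) →
      ∀ (e : (thetaIndex X).Caps (labelSucc i₀) → (thetaIndex X).Fibre (.inr pp)) (a : (thetaIndex X).Caps (labelSucc i₀))
        (i : DIdx pp.1 ((presAt X hlog pp).kk e)), ‖t pp i₀ (e a)‖ ≤ ‖c ⟨e, i⟩‖ := by
  haveI : Fact (pp : ℕ).Prime := ⟨pp.2⟩
  set Pp := presAt X hlog pp with hPp
  intro c hc e a i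
  set σ : Equiv.Perm ((thetaIndex X).Caps (labelSucc i₀)) := Equiv.swap a (Fin.last _) with hσ
  have hσa : σ (Fin.last _) = a := by rw [hσ, Equiv.swap_apply_right]
  -- the point `e⁻¹((ι_a(t_{Θ,i+1,v_a}))_{v⃗})`
  obtain ⟨x, hx⟩ := Pp.comparison_surjective (labelSucc i₀) fun e' =>
    iota pp.1 (Pp.kk e') (σ (Fin.last _)) (labelIdele X t pp (labelSucc i₀) (e' (σ (Fin.last _))))
  -- it lies in the `σ`-permuted (Ind3)-region, a possible image, hence in the hull-set
  have hxU : x ∈ (logShellsDH X logv).permute (labelSucc i₀) (.inr pp) σ ''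
      (settingPrVolSharp X hlog M archPk archSub Ψ act Mmod region n lat sig split qData tq t htq0 htq1).thetaRegion3
        (labelSucc i₀) (.inr pp) := by
    rw [permute_image_thetaRegion3_settingPrVolSharp, Set.mem_preimage, hx, Set.mem_univ_pi]
    intro e'
    exact Set.mem_smul_set.mpr ⟨1, (normalizedPacket pp.1 (Pp.kk e')).one_mem, by rw [smul_eq_mul, mul_one]⟩
  have hxH := hc (Set.subset_sUnion_of_mem (permute_image_thetaRegion3_mem_possibleImages X hlog M archPk archSub Ψ act
    Mmod region n lat sig split qData t tq htq0 htq1 (labelSucc i₀) (.inr pp) σ) hxU)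
  have hxH' : (fun s => Pp.factorMap (labelSucc i₀) x s) ∈ hullSet (Pp.factorField _) c := hxH
  rw [hullSet, mem_polydisc] at hxH'
  have h := hxH' ⟨e, i⟩
  have hcoord : Pp.factorMap (labelSucc i₀) x ⟨e, i⟩ =
      dEquiv pp.1 (Pp.kk e) (iota pp.1 (Pp.kk e) (σ (Fin.last _))
        (labelIdele X t pp (labelSucc i₀) (e (σ (Fin.last _))))) i := by
    show dEquiv pp.1 (Pp.kk e) (Pp.comparison (labelSucc i₀) x e) i = _
    rw [hx]
  rw [hcoord, norm_dEquiv_iota, labelIdele_labelSucc, hσa] at h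
  exact h

/-! ## §3. The symmetrised sharp volume is a LOWER bound for `−|log(Θ)|_{i+1,p}` at every prime -/

/-- **`Σ_{v⃗} Pr(v⃗)·log max_a ‖t_{Θ,i+1,v_a}‖ ≤ −|log(Θ)|_{i+1,p}` at `settingPrVolSharp`, at EVERY prime** (Θ- and q-ideles
non-zero, units off `S`): the hull-set `e⁻¹(λ⋆·𝒪_L)` with `‖λ⋆_{(v⃗,i)}‖ = max_a ‖t_{Θ,i+1,v_a}‖` lies inside every hull-set
containing the union of the possible images (§2), hence inside the holomorphic hull `^{n,∘}𝒰_{i+1,p}`; log-volume is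
monotone on admissible regions (abc-iut-c312-6 `BridgeHyps.mono`, a theorem here: abc-iut-c312-7
`bridgeHyps_settingPrVolSharp_of_ideles`) and the volume of that hull-set is `Σ_{v⃗} Pr(v⃗)·log max_a ‖t_{Θ,i+1,v_a}‖`
(p437284 `logvol_situationPrVol_preimage_hullSet_of_norm_eq`). Together with p437284's
`thetaLocal_settingPrVolSharp_untopD_le`: `MAIN ≤ −|log(Θ)|_{i+1,p} ≤ log(p²·R/r) + MAIN`. [claim: Mochizuki2012, status: disputed]
[cite: DupuyHilado2025, §4.7, §4.12] -/
theorem sum_log_max_norm_le_thetaLocal_settingPrVolSharp_untopD (ht0 : ∀ pp i x, t pp i x ≠ 0)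
    (ht1 : ∀ (pp : Nat.Primes) (i : Fin X.lstar) (x : (thetaIndex X).Fibre (.inr pp)),
      haveI : Fact (pp : ℕ).Prime := ⟨pp.2⟩; placeOf X pp.1 x ∉ X.S → ‖t pp i x‖ = 1)
    (pp : Nat.Primes) (i₀ : Fin (thetaIndex X).lstar) :
    haveI : Fact (pp : ℕ).Prime := ⟨pp.2⟩
    (∑ e : (presAtPr X hlog pp).toLocalPieces.E (labelSucc i₀),
        (presAtPr X hlog pp).w (labelSucc i₀) e *
          Real.log (Finset.univ.sup' ⟨0, Finset.mem_univ _⟩ fun a => ‖t pp i₀ (e a)‖)) ≤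
      ((settingPrVolSharp X hlog M archPk archSub Ψ act Mmod region n lat sig split qData tq t htq0 htq1).thetaLocal
        (labelSucc i₀) (.inr pp)).untopD 0 := by
  haveI : Fact (pp : ℕ).Prime := ⟨pp.2⟩
  classical
  set Pp := presAt X hlog pp with hPp
  set P := settingPrVolSharp X hlog M archPk archSub Ψ act Mmod region n lat sig split qData tq t htq0 htq1 with hP
  have H := bridgeHyps_settingPrVolSharp_of_ideles X hlog M archPk archSub Ψ act Mmod region n lat sig split qData t tq ht0
    ht1 htq0 htq1
  -- the slot of maximal idele norm, tuple by tuple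
  have hmax : ∀ e : (thetaIndex X).Caps (labelSucc i₀) → (thetaIndex X).Fibre (.inr pp),
      ∃ a, ∀ b, ‖t pp i₀ (e b)‖ ≤ ‖t pp i₀ (e a)‖ := fun e => by
    obtain ⟨a, -, ha⟩ := Finset.exists_max_image Finset.univ (fun b => ‖t pp i₀ (e b)‖) ⟨0, Finset.mem_univ _⟩
    exact ⟨a, fun b => ha b (Finset.mem_univ b)⟩
  choose amax hamax using hmax
  have hsup : ∀ e : (thetaIndex X).Caps (labelSucc i₀) → (thetaIndex X).Fibre (.inr pp),
      (Finset.univ.sup' ⟨0, Finset.mem_univ _⟩ fun a => ‖t pp i₀ (e a)‖) = ‖t pp i₀ (e (amax e))‖ := fun e =>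
    le_antisymm (Finset.sup'_le _ _ fun b _ => hamax e b)
      (Finset.le_sup' (fun a => ‖t pp i₀ (e a)‖) (Finset.mem_univ (amax e)))
  -- the centre `λ⋆` of maximal radii and its hull-set `Hs⋆ = e⁻¹(λ⋆·𝒪_L)`
  set lam : ∀ s : Pp.factorIdx (labelSucc i₀), Pp.factorField (labelSucc i₀) s :=
    Pp.centreOf fun e => iota pp.1 (Pp.kk e) (amax e) (t pp i₀ (e (amax e))) with hlam
  have hlam_norm : ∀ e i, ‖lam ⟨e, i⟩‖ = Finset.univ.sup' ⟨0, Finset.mem_univ _⟩ fun a => ‖t pp i₀ (e a)‖ := by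
    intro e i
    rw [hsup e]
    exact norm_dEquiv_iota pp.1 (Pp.kk e) (amax e) _ i
  have hlam_ne : ∀ s, lam s ≠ 0 := fun s => by
    obtain ⟨e, i⟩ := s
    exact dEquiv_iota_ne_zero pp.1 (Pp.kk e) (amax e) (ht0 pp i₀ _) i
  set Hs : Set ((logShellsDH X logv).Packet (labelSucc i₀) (.inr pp)) :=
    (fun x => Pp.factorMap (labelSucc i₀) x) ⁻¹' hullSet (Pp.factorField _) lam with hHs
  have hHul : Hs ∈ (P.frame (labelSucc i₀) (.inr pp)).Hul := ⟨_, ⟨lam, hlam_ne, rfl⟩, rfl⟩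
  -- `Hs⋆` lies in every hull-set containing the union of the possible images, hence in the hull
  have hsub : Hs ⊆ P.thetaHull (labelSucc i₀) (.inr pp) := by
    intro x hx
    have hx' : (fun s => Pp.factorMap (labelSucc i₀) x s) ∈ hullSet (Pp.factorField _) lam := hx
    rw [hullSet, mem_polydisc] at hx'
    have key : ∀ H ∈ (P.frame (labelSucc i₀) (.inr pp)).Hul, ⋃₀ P.possibleImages (labelSucc i₀) (.inr pp) ⊆ H → x ∈ H := by
      rintro H ⟨H', ⟨c, hc, rfl⟩, rfl⟩ hUH
      show (fun s => Pp.factorMap (labelSucc i₀) x s) ∈ hullSet (Pp.factorField _) c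
      rw [hullSet, mem_polydisc]
      rintro ⟨e, i⟩
      refine (hx' ⟨e, i⟩).trans ?_
      rw [hlam_norm e i, hsup e]
      exact norm_le_of_hullSet_of_sUnion_possibleImages_subset X hlog M archPk archSub Ψ act Mmod region n lat sig split
        qData t tq htq0 htq1 pp i₀ c hUH e (amax e) i
    show x ∈ (P.frame (labelSucc i₀) (.inr pp)).hull (⋃₀ P.possibleImages (labelSucc i₀) (.inr pp))
    unfold HullFrame.hull
    split_ifs
    · exact Set.mem_sInter.mpr fun H hH => key H hH.1 hH.2
    · exact Set.mem_univ _
  -- monotone log-volume, and the volume of `Hs⋆`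
  have hmono := H.mono i₀ (.inr pp) (P.hul_adm _ _ _ hHul) (P.thetaHull_adm (hullDefined_of_finite H i₀ (.inr pp))) hsub
  rw [thetaLocal_untopD H i₀ (.inr pp)]
  refine le_trans (le_of_eq ?_) hmono
  have hν : ∀ e : (thetaIndex X).Caps (labelSucc i₀) → (thetaIndex X).Fibre (.inr pp),
      0 < Finset.univ.sup' ⟨0, Finset.mem_univ _⟩ fun a => ‖t pp i₀ (e a)‖ := fun e =>
    lt_of_lt_of_le (norm_pos_iff.mpr (ht0 pp i₀ (e 0))) (Finset.le_sup' (fun a => ‖t pp i₀ (e a)‖) (Finset.mem_univ 0))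
  have hvol := logvol_situationPrVol_preimage_hullSet_of_norm_eq X hlog M archPk archSub Ψ act Mmod region n pp (labelSucc i₀)
    lam (fun e => Finset.univ.sup' ⟨0, Finset.mem_univ _⟩ fun a => ‖t pp i₀ (e a)‖) hν hlam_norm
  change ((situationPrVol X hlog M archPk archSub Ψ act Mmod region).D n).logvol (labelSucc i₀) (.inr pp) Hs = _ at hvol
  change _ = ((situationPrVol X hlog M archPk archSub Ψ act Mmod region).D n).logvol (labelSucc i₀) (.inr pp) Hs
  rw [hvol]

end Real

end Thm311

end IUTFork

end Summit.ABC

end
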